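import Summits.CriticalPhenomena.PercolationContinuityZ3.Theorems.PercNearOneGluingNoHeavyLowerTailTieLocusCorner
import Summits.CriticalPhenomena.PercolationContinuityZ3.Theorems.PercNearOneGluingNoHeavyLowerTailMergeStability
import HarnessLib

/-!
# `NoHeavyLowerTail` (stmt-CriticalPhenomena-4575) — the TIE LOCUS: every violation of a champion
# inequality can be pushed to an exact champion tie, and to an all-critical point (multi-affine pushing)

Support file (prover `prim-hp-8`, technique "tie/glue-locus exclusion"; `--supports stmt-CriticalPhenomena-4575`).
No definitions, no named facts, no sorries.

The attached-champion inequality XZ (`stub_attachedChampion`: `μ(1 ≤ N ≤ j) ≤ μ(|π(q)| ≤ j ∧ 1 ≤ N)` for every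
level-`j` champion `q`, i.e. every relay maximising `μ(|π(·)| ≤ j)`) and the cumulative isolation lemma at a
champion (`μ(1 ≤ N ≤ j) ≤ μ(|π(q)| ≤ j)`, whose existential form is the crux's residual `stub_cumulativeIsolation`)
are inequalities `F(w) ≥ 0` between `prodBernoulli w`-probabilities of FIXED events, required on the feasible
region `K_q = {w : μ_w(R_x) ≤ μ_w(R_q) ∀ x ∈ A}`.  Every such probability is affine in each single weight (one-bond
decomposition), so `F` and the constraints are coordinatewise affine.  Consequences (all levels `j`, all `|A|`, all
weighted graphs; the censuses report margin `0` exactly on the tie/glue locus — this file proves the locus is where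
any counterexample can be taken to live):

(Abstract pushing lemmas: part 1 `…TieLocusTools`; Dirac corners and XZ / CIL at deterministic weights: part 2
`…TieLocusCorner`.)
* `attachedChampion_exists_tied_violation`: if XZ fails for the champion `q` at `w`, it fails for `q` at some
  `w'` with the same `0/1`-weights at which `q` is TIED (`μ(R_x) = μ(R_q)`, `x ≠ q`).  Rigorous form of the census
  protocol "search the exact champion ties": ties on supports with `≤ m` random edges cover all weights there.
* `attachedChampion_exists_critical_violation`: … or at some `w'` at which every edge with `0 < w' e < 1` is
  critical for `q` (deleting it or gluing it dethrones `q`): a minimal counterexample has no idle random edge.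
* `attachedChampion_of_tied`: XZ at tied champions ⇒ XZ (conclusion = `stub_attachedChampion` verbatim).
* `cumulativeIsolation_of_tiedChampion`: CIL at tied champions ⇒ `stub_cumulativeIsolation` verbatim;
  `noHeavyLowerTail_of_tiedChampion`: ⇒ the crux.
-/

noncomputable section

namespace Summit.CriticalPhenomena.PercolationContinuityZ3.Theorems

namespace TieLocus

open MeasureTheory Set Literature.Probability.LatticeModels Literature.Probability.Percolation
open scoped Classical BigOperators

variable {n : ℕ}

/-- **Tie reduction for the attached-champion inequality XZ (`stub_attachedChampion`).**  If XZ holds at every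
weight vector at which the champion `q` is TIED with another relay (`μ(R_x) = μ(R_q)` for some `x ∈ A`,
`x ≠ q`), then XZ holds everywhere.  The conclusion is the registered stub `stub_attachedChampion` verbatim.
Proof: `TieLocus.nonneg_of_corners_of_ties` with `F = μ(R_q ∩ 𝔸) − μ(L)` and `D x = μ(R_q) − μ(R_x)`, all
affine in each weight by the one-bond decomposition; corners by `attachedChampion_corner`. -/
theorem attachedChampion_of_tied
    (hT : ∀ (n : ℕ) (w : Sym2 (Fin n) → unitInterval) (A : Finset (Fin n)) (o q : Fin n) (j : ℕ),
      o ∉ A → q ∈ A →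
      (∀ a ∈ A,
        (Literature.Probability.LatticeModels.prodBernoulli w).real
            {ω : Literature.Probability.Percolation.BondConfig (Fin n) |
              (A.filter fun x => ω ∈ Literature.Probability.Percolation.openConn a x).card ≤ j} ≤
          (Literature.Probability.LatticeModels.prodBernoulli w).real
            {ω : Literature.Probability.Percolation.BondConfig (Fin n) |
              (A.filter fun x => ω ∈ Literature.Probability.Percolation.openConn q x).card ≤ j}) →
      (∃ x ∈ A, x ≠ q ∧
        (Literature.Probability.LatticeModels.prodBernoulli w).real
            {ω : Literature.Probability.Percolation.BondConfig (Fin n) |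
              (A.filter fun y => ω ∈ Literature.Probability.Percolation.openConn x y).card ≤ j} =
          (Literature.Probability.LatticeModels.prodBernoulli w).real
            {ω : Literature.Probability.Percolation.BondConfig (Fin n) |
              (A.filter fun y => ω ∈ Literature.Probability.Percolation.openConn q y).card ≤ j}) →
      (Literature.Probability.LatticeModels.prodBernoulli w).real
          {ω : Literature.Probability.Percolation.BondConfig (Fin n) |
            1 ≤ (A.filter fun x => ω ∈ Literature.Probability.Percolation.openConn o x).card ∧
              (A.filter fun x => ω ∈ Literature.Probability.Percolation.openConn o x).card ≤ j} ≤
        (Literature.Probability.LatticeModels.prodBernoulli w).real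
          {ω : Literature.Probability.Percolation.BondConfig (Fin n) |
            (A.filter fun x => ω ∈ Literature.Probability.Percolation.openConn q x).card ≤ j ∧
              1 ≤ (A.filter fun x => ω ∈ Literature.Probability.Percolation.openConn o x).card}) :
    ∀ (n : ℕ) (w : Sym2 (Fin n) → unitInterval) (A : Finset (Fin n)) (o q : Fin n) (j : ℕ),
      o ∉ A → q ∈ A →
      (∀ a ∈ A,
        (Literature.Probability.LatticeModels.prodBernoulli w).real
            {ω : Literature.Probability.Percolation.BondConfig (Fin n) |
              (A.filter fun x => ω ∈ Literature.Probability.Percolation.openConn a x).card ≤ j} ≤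
          (Literature.Probability.LatticeModels.prodBernoulli w).real
            {ω : Literature.Probability.Percolation.BondConfig (Fin n) |
              (A.filter fun x => ω ∈ Literature.Probability.Percolation.openConn q x).card ≤ j}) →
      (Literature.Probability.LatticeModels.prodBernoulli w).real
          {ω : Literature.Probability.Percolation.BondConfig (Fin n) |
            1 ≤ (A.filter fun x => ω ∈ Literature.Probability.Percolation.openConn o x).card ∧
              (A.filter fun x => ω ∈ Literature.Probability.Percolation.openConn o x).card ≤ j} ≤
        (Literature.Probability.LatticeModels.prodBernoulli w).real
          {ω : Literature.Probability.Percolation.BondConfig (Fin n) |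
            (A.filter fun x => ω ∈ Literature.Probability.Percolation.openConn q x).card ≤ j ∧
              1 ≤ (A.filter fun x => ω ∈ Literature.Probability.Percolation.openConn o x).card} := by
  intro n w A o q j ho hq hchamp
  have key := TieLocus.nonneg_of_corners_of_ties (ι := Sym2 (Fin n)) (A.erase q)
    (fun w => (prodBernoulli w).real {ω : BondConfig (Fin n) |
        (A.filter fun x => ω ∈ openConn q x).card ≤ j ∧ 1 ≤ (A.filter fun x => ω ∈ openConn o x).card} -
      (prodBernoulli w).real {ω : BondConfig (Fin n) |
        1 ≤ (A.filter fun x => ω ∈ openConn o x).card ∧ (A.filter fun x => ω ∈ openConn o x).card ≤ j})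
    (fun x w => (prodBernoulli w).real {ω : BondConfig (Fin n) | (A.filter fun y => ω ∈ openConn q y).card ≤ j} -
      (prodBernoulli w).real {ω : BondConfig (Fin n) | (A.filter fun y => ω ∈ openConn x y).card ≤ j})
    ?hF ?hD ?hc ?ht w ?hw
  case hF =>
    intro w e
    rw [real_oneBond w e {ω : BondConfig (Fin n) |
        (A.filter fun x => ω ∈ openConn q x).card ≤ j ∧ 1 ≤ (A.filter fun x => ω ∈ openConn o x).card},
      real_oneBond w e {ω : BondConfig (Fin n) |
        1 ≤ (A.filter fun x => ω ∈ openConn o x).card ∧ (A.filter fun x => ω ∈ openConn o x).card ≤ j}]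
    ring
  case hD =>
    intro x _ w e
    rw [real_oneBond w e {ω : BondConfig (Fin n) | (A.filter fun y => ω ∈ openConn q y).card ≤ j},
      real_oneBond w e {ω : BondConfig (Fin n) | (A.filter fun y => ω ∈ openConn x y).card ≤ j}]
    ring
  case hc =>
    intro w hw hfeas
    have hch : ∀ a ∈ A,
        (prodBernoulli w).real {ω : BondConfig (Fin n) | (A.filter fun x => ω ∈ openConn a x).card ≤ j} ≤
          (prodBernoulli w).real {ω : BondConfig (Fin n) | (A.filter fun x => ω ∈ openConn q x).card ≤ j} := by
      intro a ha
      by_cases haq : a = q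
      · rw [haq]
      · have := hfeas a (Finset.mem_erase.2 ⟨haq, ha⟩); linarith
    have := attachedChampion_corner w hw A o q j hch
    linarith
  case ht =>
    intro w hfeas htie
    have hch : ∀ a ∈ A,
        (prodBernoulli w).real {ω : BondConfig (Fin n) | (A.filter fun x => ω ∈ openConn a x).card ≤ j} ≤
          (prodBernoulli w).real {ω : BondConfig (Fin n) | (A.filter fun x => ω ∈ openConn q x).card ≤ j} := by
      intro a ha
      by_cases haq : a = q
      · rw [haq]
      · have := hfeas a (Finset.mem_erase.2 ⟨haq, ha⟩); linarith
    obtain ⟨x, hx, hx0⟩ := htie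
    obtain ⟨hxq, hxA⟩ := Finset.mem_erase.1 hx
    have := hT n w A o q j ho hq hch ⟨x, hxA, hxq, by linarith⟩
    linarith
  case hw =>
    intro a ha
    have := hchamp a (Finset.mem_of_mem_erase ha)
    linarith
  linarith

/-- **Every violation of XZ can be moved to the tie locus.**  If the attached-champion inequality fails for a
champion `q` at the weights `w`, then it fails for `q` at some `w'` at which `q` is a champion TIED with another
relay `x ≠ q`, and `w'` agrees with `w` on every weight that is `0` or `1` (the random support does not grow).
This is the rigorous form of "search the champion ties": a census of XZ restricted to exact ties on supports
with `≤ m` random edges is complete for all weight vectors on those supports. [folklore] -/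
theorem attachedChampion_exists_tied_violation (w : Sym2 (Fin n) → unitInterval) (A : Finset (Fin n))
    (o q : Fin n) (j : ℕ)
    (hchamp : ∀ a ∈ A,
      (prodBernoulli w).real {ω : BondConfig (Fin n) | (A.filter fun x => ω ∈ openConn a x).card ≤ j} ≤
        (prodBernoulli w).real {ω : BondConfig (Fin n) | (A.filter fun x => ω ∈ openConn q x).card ≤ j})
    (hviol : (prodBernoulli w).real {ω : BondConfig (Fin n) |
        (A.filter fun x => ω ∈ openConn q x).card ≤ j ∧ 1 ≤ (A.filter fun x => ω ∈ openConn o x).card} <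
      (prodBernoulli w).real {ω : BondConfig (Fin n) |
        1 ≤ (A.filter fun x => ω ∈ openConn o x).card ∧ (A.filter fun x => ω ∈ openConn o x).card ≤ j}) :
    ∃ w' : Sym2 (Fin n) → unitInterval,
      (∀ a ∈ A,
        (prodBernoulli w').real {ω : BondConfig (Fin n) | (A.filter fun x => ω ∈ openConn a x).card ≤ j} ≤
          (prodBernoulli w').real {ω : BondConfig (Fin n) | (A.filter fun x => ω ∈ openConn q x).card ≤ j}) ∧
      (∃ x ∈ A, x ≠ q ∧
        (prodBernoulli w').real {ω : BondConfig (Fin n) | (A.filter fun y => ω ∈ openConn x y).card ≤ j} =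
          (prodBernoulli w').real {ω : BondConfig (Fin n) | (A.filter fun y => ω ∈ openConn q y).card ≤ j}) ∧
      (prodBernoulli w').real {ω : BondConfig (Fin n) |
          (A.filter fun x => ω ∈ openConn q x).card ≤ j ∧ 1 ≤ (A.filter fun x => ω ∈ openConn o x).card} <
        (prodBernoulli w').real {ω : BondConfig (Fin n) |
          1 ≤ (A.filter fun x => ω ∈ openConn o x).card ∧ (A.filter fun x => ω ∈ openConn o x).card ≤ j} ∧
      ∀ e, ((w e : ℝ) = 0 ∨ (w e : ℝ) = 1) → w' e = w e := by
  have H := TieLocus.exists_tie_of_neg (ι := Sym2 (Fin n)) (A.erase q)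
    (fun w => (prodBernoulli w).real {ω : BondConfig (Fin n) |
        (A.filter fun x => ω ∈ openConn q x).card ≤ j ∧ 1 ≤ (A.filter fun x => ω ∈ openConn o x).card} -
      (prodBernoulli w).real {ω : BondConfig (Fin n) |
        1 ≤ (A.filter fun x => ω ∈ openConn o x).card ∧ (A.filter fun x => ω ∈ openConn o x).card ≤ j})
    (fun x w => (prodBernoulli w).real {ω : BondConfig (Fin n) | (A.filter fun y => ω ∈ openConn q y).card ≤ j} -
      (prodBernoulli w).real {ω : BondConfig (Fin n) | (A.filter fun y => ω ∈ openConn x y).card ≤ j})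
    ?hF ?hD ?hc w ?hw (by linarith)
  case hF =>
    intro w e
    rw [real_oneBond w e {ω : BondConfig (Fin n) |
        (A.filter fun x => ω ∈ openConn q x).card ≤ j ∧ 1 ≤ (A.filter fun x => ω ∈ openConn o x).card},
      real_oneBond w e {ω : BondConfig (Fin n) |
        1 ≤ (A.filter fun x => ω ∈ openConn o x).card ∧ (A.filter fun x => ω ∈ openConn o x).card ≤ j}]
    ring
  case hD =>
    intro x _ w e
    rw [real_oneBond w e {ω : BondConfig (Fin n) | (A.filter fun y => ω ∈ openConn q y).card ≤ j},
      real_oneBond w e {ω : BondConfig (Fin n) | (A.filter fun y => ω ∈ openConn x y).card ≤ j}]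
    ring
  case hc =>
    intro w hw hfeas
    have hch : ∀ a ∈ A,
        (prodBernoulli w).real {ω : BondConfig (Fin n) | (A.filter fun x => ω ∈ openConn a x).card ≤ j} ≤
          (prodBernoulli w).real {ω : BondConfig (Fin n) | (A.filter fun x => ω ∈ openConn q x).card ≤ j} := by
      intro a ha
      by_cases haq : a = q
      · rw [haq]
      · have := hfeas a (Finset.mem_erase.2 ⟨haq, ha⟩); linarith
    have := attachedChampion_corner w hw A o q j hch
    linarith
  case hw =>
    intro a ha
    have := hchamp a (Finset.mem_of_mem_erase ha)
    linarith
  obtain ⟨w', hfeas, htie, hneg, hsupp⟩ := H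
  refine ⟨w', ?_, ?_, by linarith, hsupp⟩
  · intro a ha
    by_cases haq : a = q
    · rw [haq]
    · have := hfeas a (Finset.mem_erase.2 ⟨haq, ha⟩); linarith
  · obtain ⟨x, hx, hx0⟩ := htie
    obtain ⟨hxq, hxA⟩ := Finset.mem_erase.1 hx
    exact ⟨x, hxA, hxq, by linarith⟩

/-- **Every violation of XZ can be moved to an ALL-CRITICAL point.**  If XZ fails for the champion `q` at `w`,
it fails for the champion `q` at some `w'` (same `0/1` weights) at which every edge `e` with `0 < w' e < 1` is
CRITICAL for `q`: deleting `e` (`w'[e ↦ 0]`) or gluing `e` (`w'[e ↦ 1]`) makes some relay strictly lighter-prone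
than `q`.  So a minimal counterexample has no "idle" random edge. [folklore] -/
theorem attachedChampion_exists_critical_violation (w : Sym2 (Fin n) → unitInterval) (A : Finset (Fin n))
    (o q : Fin n) (j : ℕ)
    (hchamp : ∀ a ∈ A,
      (prodBernoulli w).real {ω : BondConfig (Fin n) | (A.filter fun x => ω ∈ openConn a x).card ≤ j} ≤
        (prodBernoulli w).real {ω : BondConfig (Fin n) | (A.filter fun x => ω ∈ openConn q x).card ≤ j})
    (hviol : (prodBernoulli w).real {ω : BondConfig (Fin n) |
        (A.filter fun x => ω ∈ openConn q x).card ≤ j ∧ 1 ≤ (A.filter fun x => ω ∈ openConn o x).card} <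
      (prodBernoulli w).real {ω : BondConfig (Fin n) |
        1 ≤ (A.filter fun x => ω ∈ openConn o x).card ∧ (A.filter fun x => ω ∈ openConn o x).card ≤ j}) :
    ∃ w' : Sym2 (Fin n) → unitInterval,
      (∀ a ∈ A,
        (prodBernoulli w').real {ω : BondConfig (Fin n) | (A.filter fun x => ω ∈ openConn a x).card ≤ j} ≤
          (prodBernoulli w').real {ω : BondConfig (Fin n) | (A.filter fun x => ω ∈ openConn q x).card ≤ j}) ∧
      (prodBernoulli w').real {ω : BondConfig (Fin n) |
          (A.filter fun x => ω ∈ openConn q x).card ≤ j ∧ 1 ≤ (A.filter fun x => ω ∈ openConn o x).card} <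
        (prodBernoulli w').real {ω : BondConfig (Fin n) |
          1 ≤ (A.filter fun x => ω ∈ openConn o x).card ∧ (A.filter fun x => ω ∈ openConn o x).card ≤ j} ∧
      (∀ e, ((w e : ℝ) = 0 ∨ (w e : ℝ) = 1) → w' e = w e) ∧
      ∀ e, (w' e : ℝ) ≠ 0 ∧ (w' e : ℝ) ≠ 1 →
        (∃ x ∈ A,
          (prodBernoulli (Function.update w' e 0)).real
              {ω : BondConfig (Fin n) | (A.filter fun y => ω ∈ openConn q y).card ≤ j} <
            (prodBernoulli (Function.update w' e 0)).real
              {ω : BondConfig (Fin n) | (A.filter fun y => ω ∈ openConn x y).card ≤ j}) ∨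
        (∃ x ∈ A,
          (prodBernoulli (Function.update w' e 1)).real
              {ω : BondConfig (Fin n) | (A.filter fun y => ω ∈ openConn q y).card ≤ j} <
            (prodBernoulli (Function.update w' e 1)).real
              {ω : BondConfig (Fin n) | (A.filter fun y => ω ∈ openConn x y).card ≤ j}) := by
  have H := TieLocus.exists_allCritical_of_neg (ι := Sym2 (Fin n)) (A.erase q)
    (fun w => (prodBernoulli w).real {ω : BondConfig (Fin n) |
        (A.filter fun x => ω ∈ openConn q x).card ≤ j ∧ 1 ≤ (A.filter fun x => ω ∈ openConn o x).card} -
      (prodBernoulli w).real {ω : BondConfig (Fin n) |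
        1 ≤ (A.filter fun x => ω ∈ openConn o x).card ∧ (A.filter fun x => ω ∈ openConn o x).card ≤ j})
    (fun x w => (prodBernoulli w).real {ω : BondConfig (Fin n) | (A.filter fun y => ω ∈ openConn q y).card ≤ j} -
      (prodBernoulli w).real {ω : BondConfig (Fin n) | (A.filter fun y => ω ∈ openConn x y).card ≤ j})
    ?hF w ?hw (by linarith)
  case hF =>
    intro w e
    rw [real_oneBond w e {ω : BondConfig (Fin n) |
        (A.filter fun x => ω ∈ openConn q x).card ≤ j ∧ 1 ≤ (A.filter fun x => ω ∈ openConn o x).card},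
      real_oneBond w e {ω : BondConfig (Fin n) |
        1 ≤ (A.filter fun x => ω ∈ openConn o x).card ∧ (A.filter fun x => ω ∈ openConn o x).card ≤ j}]
    ring
  case hw =>
    intro a ha
    have := hchamp a (Finset.mem_of_mem_erase ha)
    linarith
  obtain ⟨w', hfeas, hneg, hsupp, hcrit⟩ := H
  refine ⟨w', ?_, by linarith, hsupp, fun e he => ?_⟩
  · intro a ha
    by_cases haq : a = q
    · rw [haq]
    · have := hfeas a (Finset.mem_erase.2 ⟨haq, ha⟩); linarith
  · rcases hcrit e he with ⟨x, hx, hlt⟩ | ⟨x, hx, hlt⟩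
    · exact Or.inl ⟨x, Finset.mem_of_mem_erase hx, by linarith⟩
    · exact Or.inr ⟨x, Finset.mem_of_mem_erase hx, by linarith⟩

/-- **Tie reduction for the cumulative isolation lemma** (`stub_cumulativeIsolation`, the crux's residual):
if `μ(1 ≤ N ≤ j) ≤ μ(|π(q)| ≤ j)` holds for every champion `q` that is TIED with another relay, then the
cumulative isolation lemma holds (conclusion = the registered stub verbatim; the witness is any champion).
[folklore] -/
theorem cumulativeIsolation_of_tiedChampion
    (hT : ∀ (n : ℕ) (w : Sym2 (Fin n) → unitInterval) (A : Finset (Fin n)) (o q : Fin n) (j : ℕ),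
      o ∉ A → q ∈ A →
      (∀ a ∈ A,
        (Literature.Probability.LatticeModels.prodBernoulli w).real
            {ω : Literature.Probability.Percolation.BondConfig (Fin n) |
              (A.filter fun x => ω ∈ Literature.Probability.Percolation.openConn a x).card ≤ j} ≤
          (Literature.Probability.LatticeModels.prodBernoulli w).real
            {ω : Literature.Probability.Percolation.BondConfig (Fin n) |
              (A.filter fun x => ω ∈ Literature.Probability.Percolation.openConn q x).card ≤ j}) →
      (∃ x ∈ A, x ≠ q ∧
        (Literature.Probability.LatticeModels.prodBernoulli w).real
            {ω : Literature.Probability.Percolation.BondConfig (Fin n) |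
              (A.filter fun y => ω ∈ Literature.Probability.Percolation.openConn x y).card ≤ j} =
          (Literature.Probability.LatticeModels.prodBernoulli w).real
            {ω : Literature.Probability.Percolation.BondConfig (Fin n) |
              (A.filter fun y => ω ∈ Literature.Probability.Percolation.openConn q y).card ≤ j}) →
      (Literature.Probability.LatticeModels.prodBernoulli w).real
          {ω : Literature.Probability.Percolation.BondConfig (Fin n) |
            1 ≤ (A.filter fun x => ω ∈ Literature.Probability.Percolation.openConn o x).card ∧
              (A.filter fun x => ω ∈ Literature.Probability.Percolation.openConn o x).card ≤ j} ≤
        (Literature.Probability.LatticeModels.prodBernoulli w).real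
          {ω : Literature.Probability.Percolation.BondConfig (Fin n) |
            (A.filter fun x => ω ∈ Literature.Probability.Percolation.openConn q x).card ≤ j}) :
    ∀ (n : ℕ) (w : Sym2 (Fin n) → unitInterval) (A : Finset (Fin n)) (o : Fin n) (j : ℕ),
      A.Nonempty → o ∉ A → ∃ a ∈ A,
        (Literature.Probability.LatticeModels.prodBernoulli w).real
            {ω : Literature.Probability.Percolation.BondConfig (Fin n) |
              1 ≤ (A.filter fun x => ω ∈ Literature.Probability.Percolation.openConn o x).card ∧
                (A.filter fun x => ω ∈ Literature.Probability.Percolation.openConn o x).card ≤ j} ≤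
          (Literature.Probability.LatticeModels.prodBernoulli w).real
            {ω : Literature.Probability.Percolation.BondConfig (Fin n) |
              (A.filter fun x => ω ∈ Literature.Probability.Percolation.openConn a x).card ≤ j} := by
  intro n w A o j hA ho
  obtain ⟨q, hq, hchamp⟩ := MergeStability.exists_champion (prodBernoulli w) A hA j
  refine ⟨q, hq, ?_⟩
  have key := TieLocus.nonneg_of_corners_of_ties (ι := Sym2 (Fin n)) (A.erase q)
    (fun w => (prodBernoulli w).real {ω : BondConfig (Fin n) | (A.filter fun x => ω ∈ openConn q x).card ≤ j} -
      (prodBernoulli w).real {ω : BondConfig (Fin n) |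
        1 ≤ (A.filter fun x => ω ∈ openConn o x).card ∧ (A.filter fun x => ω ∈ openConn o x).card ≤ j})
    (fun x w => (prodBernoulli w).real {ω : BondConfig (Fin n) | (A.filter fun y => ω ∈ openConn q y).card ≤ j} -
      (prodBernoulli w).real {ω : BondConfig (Fin n) | (A.filter fun y => ω ∈ openConn x y).card ≤ j})
    ?hF ?hD ?hc ?ht w ?hw
  case hF =>
    intro w e
    rw [real_oneBond w e {ω : BondConfig (Fin n) | (A.filter fun x => ω ∈ openConn q x).card ≤ j},
      real_oneBond w e {ω : BondConfig (Fin n) |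
        1 ≤ (A.filter fun x => ω ∈ openConn o x).card ∧ (A.filter fun x => ω ∈ openConn o x).card ≤ j}]
    ring
  case hD =>
    intro x _ w e
    rw [real_oneBond w e {ω : BondConfig (Fin n) | (A.filter fun y => ω ∈ openConn q y).card ≤ j},
      real_oneBond w e {ω : BondConfig (Fin n) | (A.filter fun y => ω ∈ openConn x y).card ≤ j}]
    ring
  case hc =>
    intro w hw hfeas
    have hch : ∀ a ∈ A,
        (prodBernoulli w).real {ω : BondConfig (Fin n) | (A.filter fun x => ω ∈ openConn a x).card ≤ j} ≤
          (prodBernoulli w).real {ω : BondConfig (Fin n) | (A.filter fun x => ω ∈ openConn q x).card ≤ j} := by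
      intro a ha
      by_cases haq : a = q
      · rw [haq]
      · have := hfeas a (Finset.mem_erase.2 ⟨haq, ha⟩); linarith
    have := cumulativeIsolation_corner w hw A o q j hch
    linarith
  case ht =>
    intro w hfeas htie
    have hch : ∀ a ∈ A,
        (prodBernoulli w).real {ω : BondConfig (Fin n) | (A.filter fun x => ω ∈ openConn a x).card ≤ j} ≤
          (prodBernoulli w).real {ω : BondConfig (Fin n) | (A.filter fun x => ω ∈ openConn q x).card ≤ j} := by
      intro a ha
      by_cases haq : a = q
      · rw [haq]
      · have := hfeas a (Finset.mem_erase.2 ⟨haq, ha⟩); linarith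
    obtain ⟨x, hx, hx0⟩ := htie
    obtain ⟨hxq, hxA⟩ := Finset.mem_erase.1 hx
    have := hT n w A o q j ho hq hch ⟨x, hxA, hxq, by linarith⟩
    linarith
  case hw =>
    intro a ha
    have := hchamp a (Finset.mem_of_mem_erase ha)
    linarith
  linarith

/-- **The crux from the tie locus.**  `NoHeavyLowerTail` follows from the cumulative isolation lemma restricted
to TIED champions (through `cumulativeIsolation_of_tiedChampion` and the landed
`noHeavyLowerTail_of_stub_cumulativeIsolation`). -/
theorem noHeavyLowerTail_of_tiedChampion
    (hT : ∀ (n : ℕ) (w : Sym2 (Fin n) → unitInterval) (A : Finset (Fin n)) (o q : Fin n) (j : ℕ),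
      o ∉ A → q ∈ A →
      (∀ a ∈ A,
        (Literature.Probability.LatticeModels.prodBernoulli w).real
            {ω : Literature.Probability.Percolation.BondConfig (Fin n) |
              (A.filter fun x => ω ∈ Literature.Probability.Percolation.openConn a x).card ≤ j} ≤
          (Literature.Probability.LatticeModels.prodBernoulli w).real
            {ω : Literature.Probability.Percolation.BondConfig (Fin n) |
              (A.filter fun x => ω ∈ Literature.Probability.Percolation.openConn q x).card ≤ j}) →
      (∃ x ∈ A, x ≠ q ∧
        (Literature.Probability.LatticeModels.prodBernoulli w).real
            {ω : Literature.Probability.Percolation.BondConfig (Fin n) |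
              (A.filter fun y => ω ∈ Literature.Probability.Percolation.openConn x y).card ≤ j} =
          (Literature.Probability.LatticeModels.prodBernoulli w).real
            {ω : Literature.Probability.Percolation.BondConfig (Fin n) |
              (A.filter fun y => ω ∈ Literature.Probability.Percolation.openConn q y).card ≤ j}) →
      (Literature.Probability.LatticeModels.prodBernoulli w).real
          {ω : Literature.Probability.Percolation.BondConfig (Fin n) |
            1 ≤ (A.filter fun x => ω ∈ Literature.Probability.Percolation.openConn o x).card ∧
              (A.filter fun x => ω ∈ Literature.Probability.Percolation.openConn o x).card ≤ j} ≤
        (Literature.Probability.LatticeModels.prodBernoulli w).real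
          {ω : Literature.Probability.Percolation.BondConfig (Fin n) |
            (A.filter fun x => ω ∈ Literature.Probability.Percolation.openConn q x).card ≤ j}) :
    Summit.CriticalPhenomena.PercolationContinuityZ3.Theses.PercNearOneGluing.NoHeavyLowerTail :=
  noHeavyLowerTail_of_stub_cumulativeIsolation (cumulativeIsolation_of_tiedChampion hT)

end TieLocus

end Summit.CriticalPhenomena.PercolationContinuityZ3.Theorems

end
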